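import Literature.Probability.LatticeModels.IsoradialPercolation
import Literature.Probability.Percolation.Percolation
import HarnessLib

/-!
# The weak percolation-EKR hypothesis of `HubOnly.majorityGluing_two_of_weakPercEKR` (p312163), AS TYPED, is false
# (lane prim-rate, audit seat 3, gen 7 — T5-style consistency check of a landed multi-hypothesis conditional)

Support file for the closed crux `NoHeavyLowerTail` (stmt-CriticalPhenomena-4575; `--supports`), negative bookkeeping only.
`Summits/…/PercNearOneGluingNoHeavyLowerTailMajorityGluingHubOnlyWeak.lean:48` (constants-miner 1, row M1-E1w ⟹ M1-L2 with loss `2·max`)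
takes as hypothesis `hWEKR` a closed ∀-statement quantifying over ALL `δ : ℝ` with `δ ≤ 1/2` and ALL relay sets `T`, including the
empty one — it carries neither `0 ≤ δ` nor `T.Nonempty`.  At the degenerate instance `n = 1`, constant weight `1/2`, `T = ∅`, `a₀ = 0`,
`h = 1`, `δ = -1` every premise holds (vacuously or numerically) while the conclusion reads `μ(∅) ≤ (-1)/(1 - (-1)) = -1/2`.  Hence
`hWEKR` is FALSE as a proposition (`HubOnly.not_weakPercEKR_asTyped` below), and the conditional theorem p312163 holds VACUOUSLY as typed
(the `example` below derives an arbitrary conclusion from `hWEKR`).  WHAT IS NOT REFUTED: the miner's row M1-E1w itself — the same bound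
`μ(h ≤ #cut) ≤ δ/(1-δ)` for `0 ≤ δ ≤ 1/2` (equivalently for non-empty `T`, where `0 ≤ δ` is forced by the marginal bound); p312163's proof
instantiates `hWEKR` only at `δ = max_{a∈A} μ(a ↮ a₀) ≥ 0` (its line 108), so the conditional with `0 ≤ δ →` inserted in the hypothesis
has the same proof with `hM0 : 0 ≤ M` passed along (checked by this seat, rc 0, standard axioms; left to be landed next to p312163).
This file imports no lane-(c) file: the refutation needs only `prodBernoulli` and `openConn`.  No definitions, no sorries.
-/

noncomputable section

namespace Summit.CriticalPhenomena.PercolationContinuityZ3.Theorems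

open MeasureTheory Set
open Literature.Probability.LatticeModels (prodBernoulli)
open Literature.Probability.Percolation
open scoped Classical

namespace HubOnly

/-- **The weak percolation-EKR hypothesis of p312163, exactly as typed there (binder for binder), is false.**
Witness: `n = 1`, constant weight `1/2`, `T = ∅`, `a₀ = 0`, `h = 1`, `δ = -1`: the premises `a₀ ∉ ∅`, `0 < 2`, `-1 ≤ 1/2`,
`∀ v ∈ ∅, …` hold, the threshold event `{1 ≤ #cut(∅)}` is empty, and `0 ≤ -1/2` is absurd.
Consequence: `HubOnly.majorityGluing_two_of_weakPercEKR` (p312163) holds vacuously; the non-vacuous form needs `0 ≤ δ`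
(or `T.Nonempty`) added to the hypothesis. [folklore] -/
theorem not_weakPercEKR_asTyped :
    ¬ (∀ (n : ℕ) (p : Sym2 (Fin n) → unitInterval), (∀ e, 0 < p e ∧ p e < 1) →
      ∀ (T : Finset (Fin n)) (a₀ : Fin n) (h : ℕ) (δ : ℝ), a₀ ∉ T → T.card < 2 * h → δ ≤ 1 / 2 →
      (∀ v ∈ T, (prodBernoulli p).real (openConn v a₀ : Set (BondConfig (Fin n)))ᶜ ≤ δ) →
      (prodBernoulli p).real {ω : BondConfig (Fin n) | h ≤ (T.filter fun v => ω ∉ openConn v a₀).card} ≤ δ / (1 - δ)) := by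
  intro H
  -- constant weight 1/2 on the (single) edge slot of `Fin 1`
  let q : unitInterval := ⟨1 / 2, by norm_num, by norm_num⟩
  have hq : ∀ e : Sym2 (Fin 1), 0 < (fun _ => q) e ∧ (fun _ => q) e < 1 := by
    intro e
    refine ⟨?_, ?_⟩
    · show (0 : unitInterval) < q
      rw [← Subtype.coe_lt_coe]
      norm_num [q]
    · show q < (1 : unitInterval)
      rw [← Subtype.coe_lt_coe]
      norm_num [q]
  have hinst := H 1 (fun _ => q) hq ∅ 0 1 (-1) (by simp) (by simp) (by norm_num) (by simp)
  have hK : {ω : BondConfig (Fin 1) | 1 ≤ ((∅ : Finset (Fin 1)).filter fun v => ω ∉ openConn v 0).card} = ∅ := by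
    ext ω
    simp
  rw [hK, measureReal_empty] at hinst
  norm_num at hinst

/-- Corollary (documentation of the vacuity): ANY conclusion follows from the hypothesis as typed — in particular the
statement of p312163, with no percolation content used. [folklore] -/
example (C : Prop)
    (hWEKR : ∀ (n : ℕ) (p : Sym2 (Fin n) → unitInterval), (∀ e, 0 < p e ∧ p e < 1) →
      ∀ (T : Finset (Fin n)) (a₀ : Fin n) (h : ℕ) (δ : ℝ), a₀ ∉ T → T.card < 2 * h → δ ≤ 1 / 2 →
      (∀ v ∈ T, (prodBernoulli p).real (openConn v a₀ : Set (BondConfig (Fin n)))ᶜ ≤ δ) →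
      (prodBernoulli p).real {ω : BondConfig (Fin n) | h ≤ (T.filter fun v => ω ∉ openConn v a₀).card} ≤ δ / (1 - δ)) :
    C :=
  absurd hWEKR not_weakPercEKR_asTyped

end HubOnly

end Summit.CriticalPhenomena.PercolationContinuityZ3.Theorems

end
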